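import Literature.AlgebraicGeometry.Frobenioids.PadicFrobenioidRmk122
import Literature.AlgebraicGeometry.Frobenioids.PadicFrobenioidThm12
import HarnessLib

/-!
# Frobenioids II, Remark 1.2.2: the unit-twist self-equivalence of a `p`-adic Frobenioid (proofs)

Mochizuki, *The geometry of Frobenioids II*, Kyushu J. Math. **62** (2008), §1, Remark 1.2.2, p. 10
[cite: MochizukiFrdII2008, Rmk 1.2.2 p.10].

PROOF-ONLY companion (abc-iut node `FrdII:Rmk1.2.2`, discharge of abc-iut-L1-t4's
`PadicFrd.Rmk122_twist`, `PadicFrobenioidThm12.lean`), following print's construction as typed in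
abc-iut-L1-t4's `PadicFrobenioidRmk122.lean`:

1. SECTION: for every `A ∈ Ob(D)` the element `u_A ∈ B(A) = K_A^× ×_{Φ₀^gp} Φ^gp(A)` over
   `(1 + p ∈ O_{K_A}^×, 0)`; the `u_A` are compatible with all pull-backs (field homomorphisms fix `1 + p`)
   — a "section of `O^×(−)`" (`exists_unitSection_onePlusP`).
2. EXPONENT: for absolutely primitive `Φ` (and `Λ = ℤ`), `Div₀(b|_{K^×}) = Div₀(p)^{n_A(b)}` for a unique
   `n_A(b) ∈ ℤ` (`exists_divZeroHom_resK_eq_zpow`, `divZeroHom_primeUnit_zpow_injective`); `n_A` is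
   additive and natural in `A` (`expFn_mul`, `expFn_mapB`).
3. THE AUTOMORPHISM `U = (id_Φ, β)` of the data `(Φ, B → Φ^gp)`, `β_A(b) := b · u_A^{n_A(b)}` — it fixes
   `O^×(−)` and `Φ` and sends the rational function `p` of the generator of `τ_p` to `p · u` —, objectwise
   bijective, hence (`Datum.rmk122SelfEquivalence_holds`, abc-iut-L1-t4) a self-equivalence
   `Ψ_U : C ⥲ C` over the identity on base objects.
4. `Ψ_U ≇ 𝟭_C`: a natural isomorphism `θ`, evaluated at the base-identity endomorphism `e = (1, id, z, u_e)`
   of an object `X`, `z ≠ 0`, `u_e` over `(p^k, z)` (`k ≠ 0`), forces `u_{A}^k = 1` in `B(A)` (the base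
   component of `θ_X` acts trivially on `u_e`: `End_D(A)` acts trivially on `Φ(A)` and fixes `p`), i.e.
   `(1 + p)^k = 1` in the characteristic-zero field `K_A` — impossible.

So `Rmk122_twist` holds for EVERY absolutely primitive datum (its unit hypothesis is only used to produce an
object of `C`). Nothing here bears on the IUT claims; `Rmk 1.2.2` is not cited by [IUTchI–IV].
-/

namespace Literature.AlgebraicGeometry.Frobenioids

namespace PadicFrd

open CategoryTheory Opposite Function ValuativeRel

universe v u

namespace Datum

variable {D : Type u} [Category.{v} D] {p : ℕ} [Fact p.Prime] (d : Datum D p)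

/-- A monoid homomorphism into a group commutes with integer powers of units. [folklore] -/
private theorem map_units_zpow {M G : Type*} [Monoid M] [Group G] (f : M →* G) (c : Mˣ) (k : ℤ) :
    f ((c ^ k : Mˣ) : M) = f (c : M) ^ k := by
  rw [← Units.coe_map, map_zpow, Units.val_zpow_eq_zpow_val, Units.coe_map]

/-! ### Step 1: the section `A ↦ u_A` of `O^×(−)` over `1 + p` -/

/-- The restriction maps of the base preserve the units of the valuation rings: for `f : A → A'` and
`y ∈ O_{K_{A'}}^×`, `σ_f(y) ∈ O_{K_A}^×` (`σ_f` is valuative). [cite: MochizukiFrdII2008, Ex 1.1 (i) p.7] -/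
theorem units_map_mem_unitSubgroup {A A' : D} (f : A ⟶ A') {y : (d.fld A')ˣ}
    (hy : y ∈ unitSubgroup (d.fld A')) :
    Units.map ((d.base.map f).alg : d.fld A' →* d.fld A) y ∈ unitSubgroup (d.fld A) := by
  rw [mem_unitSubgroup_iff] at hy ⊢
  have hσ := (d.base.map f).isValHom
  have h1 : (y : d.fld A') =ᵥ 1 :=
    (Valuation.veq_iff_eq (valuation (d.fld A'))).mpr (by rw [hy, map_one])
  rw [veq_def] at h1
  have h2 : (d.base.map f).alg (y : d.fld A') =ᵥ 1 := by
    rw [veq_def]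
    have ha := hσ (y : d.fld A') 1
    have hb := hσ 1 (y : d.fld A')
    rw [map_one] at ha hb
    exact ⟨ha.mpr h1.1, hb.mpr h1.2⟩
  have h3 := (Valuation.veq_iff_eq (valuation (d.fld A))).mp h2
  rw [map_one] at h3
  rw [Units.coe_map, MonoidHom.coe_coe]
  exact h3

/-- **Step 1** — the section of `O^×(−)` over `1 + p`: units `u_A ∈ B(A)`, `A ∈ Ob(D)`, with `Div_B(u_A) = 0`,
`u_A|_{K^×} = 1 + p ∈ O_{K_A}^×`, compatible with every pull-back `B(f)` ("every arrow `φ : A_D → B_D` of `D`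
maps `u_{B_D} ↦ u_{A_D}`"). [cite: MochizukiFrdII2008, Rmk 1.2.2 p.10] -/
theorem exists_unitSection_onePlusP :
    ∃ u : ∀ A : D, (d.B.obj (op A))ˣ,
      (∀ A, Frobenioids.divB d.Φ d.B d.divB (op A) (u A : d.B.obj (op A)) = 1) ∧
      (∀ A, d.resK A (u A : d.B.obj (op A)) ∈ unitSubgroup (d.fld A)) ∧
      (∀ A, ((d.resK A (u A : d.B.obj (op A)) : (d.fld A)ˣ) : d.fld A) = 1 + (p : ℕ)) ∧
      ∀ {A A' : D} (f : A ⟶ A'), (d.B.map f.op).hom (u A' : d.B.obj (op A')) = u A := by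
  have hv : ∀ A : D, valuation (d.fld A) (1 + (p : ℕ) : d.fld A) = 1 := fun A =>
    Valuation.map_one_add_of_lt _ (d.base.obj A).p_lt
  have h0 : ∀ A : D, (1 + (p : ℕ) : d.fld A) ≠ 0 := fun A =>
    (Valuation.ne_zero_iff (valuation (d.fld A))).mp (by rw [hv A]; exact one_ne_zero)
  have hx : ∀ A : D, Units.mk0 _ (h0 A) ∈ unitSubgroup (d.fld A) := fun A => by
    rw [mem_unitSubgroup_iff, Units.val_mk0]
    exact hv A
  have hex : ∀ A : D, ∃ c : (d.B.obj (op A))ˣ,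
      Frobenioids.divB d.Φ d.B d.divB (op A) (c : d.B.obj (op A)) = 1 ∧
        d.resK A (c : d.B.obj (op A)) = Units.mk0 _ (h0 A) := fun A => by
    obtain ⟨b, hb₁, hb₂⟩ := d.exists_B_over_unit (op A) (Units.mk0 _ (h0 A)) (hx A)
    exact ⟨(d.isUnit_B (op A) b).unit, by rw [IsUnit.unit_spec]; exact hb₂,
      by rw [IsUnit.unit_spec]; exact hb₁⟩
  choose u hu₁ hu₂ using hex
  refine ⟨u, hu₁, fun A => by rw [hu₂]; exact hx A, fun A => by rw [hu₂, Units.val_mk0],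
    fun {A A'} f => ?_⟩
  apply d.resK_ext A
  · rw [d.resK_mapB, hu₂, hu₂]
    ext
    rw [Units.coe_map, MonoidHom.coe_coe, Units.val_mk0, Units.val_mk0, map_add, map_one, map_natCast]
  · rw [← pullGp_divB, hu₁, hu₁, map_one]

/-! ### Step 2: the exponent `n_A : B(A) → ℤ` -/

/-- `Div₀(p) = ord(p) ⊗ 1 ∈ Φ₀^gp(A)` is not torsion: `k ↦ Div₀(p)^k` is injective (`Φ₀(A) = ord(O_K^⊳) ⊗ ℝ_{≥0}`
is cancellative and sharp, `ord(p) ≠ 0`). [cite: MochizukiFrdII2008, Ex 1.1 (ii) p.8] -/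
theorem divZeroHom_primeUnit_zpow_injective (A : D) :
    Injective fun k : ℤ => divZeroHom (d.fld A) (d.primeUnit A) ^ k := by
  obtain ⟨⟨inst, hfin, hc⟩⟩ := d.isPadicLocal A
  letI := inst
  haveI := hfin
  haveI := isCancelMul_realification (OrdInt (d.fld A))
  rw [injective_zpow_iff_not_isOfFinOrder, isOfFinOrder_iff_pow_eq_one]
  rintro ⟨m, hm, h⟩
  have hmono : IsMonoprime (OrdInt (d.fld A)) := isMonoprime_ordInt hc
  have hsharp : IsSharp (Realification (OrdInt (d.fld A))) :=
    (IsMonoprime.ofR (isRMonoprime_realification hmono)).isSharp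
  set rp : Realification (OrdInt (d.fld A)) := Realification.of (OrdInt (d.fld A))
    (Associates.mk ⟨((p : ℕ) : d.fld A), (d.base.obj A).p_mem⟩) with hrp
  have hgen : divZeroHom (d.fld A) (d.primeUnit A) = Algebra.GrothendieckGroup.of rp := by
    rw [d.divZeroHom_primeUnit]
    rfl
  rw [hgen, ← map_pow] at h
  have h1 : rp ^ m = 1 := Algebra.GrothendieckGroup.of_injective (h.trans (map_one _).symm)
  have hrp1 : rp = 1 := hsharp.1 rp (IsUnit.of_pow_eq_one h1 hm.ne')
  have h2 : Associates.mk (⟨((p : ℕ) : d.fld A), (d.base.obj A).p_mem⟩ : intNonzero (d.fld A)) = 1 :=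
    Realification.of_injective hmono (hrp1.trans (map_one _).symm)
  rw [Associates.mk_eq_one] at h2
  exact (d.base.obj A).p_lt.ne ((isUnit_intNonzero_iff (d.fld A) _).mp h2)

/-- **Step 2**, existence: for absolutely primitive `Φ` (`Λ = ℤ`), every `b ∈ B(A)` has
`Div₀(b|_{K^×}) = ι^gp(Div_B b) = Div₀(p)^k` for some `k ∈ ℤ`. [cite: MochizukiFrdII2008, Rmk 1.2.2 p.10] -/
theorem exists_divZeroHom_resK_eq_zpow (hap : d.IsAbsolutelyPrimitive) (A : D) (b : d.B.obj (op A)) :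
    ∃ k : ℤ, divZeroHom (d.fld A) (d.resK A b) = divZeroHom (d.fld A) (d.primeUnit A) ^ k := by
  obtain ⟨k, hk⟩ := Subgroup.mem_zpowers_iff.mp
    (d.mem_zpowers_of_isAbsolutelyPrimitive hap A (Frobenioids.divB d.Φ d.B d.divB (op A) b))
  refine ⟨k, ?_⟩
  rw [d.divZeroHom_resK, d.divZeroHom_primeUnit]
  exact hk.symm

section ExpFn

variable (n : ∀ A : D, d.B.obj (op A) → ℤ)
  (hn : ∀ (A : D) (b : d.B.obj (op A)),
    divZeroHom (d.fld A) (d.resK A b) = divZeroHom (d.fld A) (d.primeUnit A) ^ n A b)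
include hn

/-- **Step 2**, uniqueness: an exponent function `n` (`Div₀(b|_{K^×}) = Div₀(p)^{n_A(b)}`) is determined
by this property. [cite: MochizukiFrdII2008, Rmk 1.2.2 p.10] -/
theorem expFn_eq {A : D} {b : d.B.obj (op A)} {k : ℤ}
    (h : divZeroHom (d.fld A) (d.resK A b) = divZeroHom (d.fld A) (d.primeUnit A) ^ k) : n A b = k :=
  d.divZeroHom_primeUnit_zpow_injective A ((hn A b).symm.trans h)

/-- `n_A` is additive. [cite: MochizukiFrdII2008, Rmk 1.2.2 p.10] -/
theorem expFn_mul (A : D) (b c : d.B.obj (op A)) : n A (b * c) = n A b + n A c :=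
  d.expFn_eq n hn (by rw [map_mul, map_mul, hn A b, hn A c, zpow_add])

/-- `n_A(1) = 0`. [cite: MochizukiFrdII2008, Rmk 1.2.2 p.10] -/
theorem expFn_one (A : D) : n A 1 = 0 :=
  d.expFn_eq n hn (by rw [map_one, map_one, zpow_zero])

/-- `n_A` vanishes on `O^×(A)|_{K^×}`-units: if `b|_{K^×} ∈ O_K^×` then `n_A(b) = 0`.
[cite: MochizukiFrdII2008, Rmk 1.2.2 p.10] -/
theorem expFn_eq_zero_of_mem {A : D} {b : d.B.obj (op A)} (hb : d.resK A b ∈ unitSubgroup (d.fld A)) :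
    n A b = 0 := by
  obtain ⟨⟨inst, hfin, hc⟩⟩ := d.isPadicLocal A
  letI := inst
  haveI := hfin
  apply d.expFn_eq n hn
  rw [zpow_zero, ← MonoidHom.mem_ker, ker_divZeroHom_eq_unitSubgroup hc]
  exact hb

/-- `n` is natural: `n_A(B(f)(b)) = n_{A'}(b)` for `f : A → A'` (write `b|_{K^×} = p^k · y`, `y ∈ O^×`; the field
homomorphism `σ_f` fixes `p` and preserves units). [cite: MochizukiFrdII2008, Rmk 1.2.2 p.10] -/
theorem expFn_mapB {A A' : D} (f : A ⟶ A') (b : d.B.obj (op A')) :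
    n A ((d.B.map f.op).hom b) = n A' b := by
  obtain ⟨⟨inst', hfin', hc'⟩⟩ := d.isPadicLocal A'
  obtain ⟨⟨inst, hfin, hc⟩⟩ := d.isPadicLocal A
  have hy : d.resK A' b * (d.primeUnit A' ^ n A' b)⁻¹ ∈ unitSubgroup (d.fld A') := by
    letI := inst'
    haveI := hfin'
    rw [← ker_divZeroHom_eq_unitSubgroup hc', MonoidHom.mem_ker, map_mul, map_inv, hn A' b, map_zpow,
      mul_inv_cancel]
  have hy' := d.units_map_mem_unitSubgroup f hy
  letI := inst
  haveI := hfin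
  rw [← ker_divZeroHom_eq_unitSubgroup hc, MonoidHom.mem_ker, map_mul, map_inv, map_zpow,
    d.units_map_primeUnit, map_mul, map_inv, map_zpow, mul_inv_eq_one] at hy'
  apply d.expFn_eq n hn
  rw [d.resK_mapB]
  exact hy'

end ExpFn

/-! ### Steps 3–4: the twist `U = (id_Φ, b ↦ b · u_A^{n_A(b)})`, `Ψ_U`, and `Ψ_U ≇ 𝟭` -/

/-- **Remark 1.2.2 — PROVED** (the typed consequence `PadicFrd.Rmk122_twist`, for EVERY absolutely primitive
datum): the automorphism `U = (id_Φ, β)`, `β_A(b) = b · u_A^{n_A(b)}`, of the data `(Φ, B → Φ^gp)` built from the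
section `u_A ↔ 1 + p` of `O^×(−)` is objectwise bijective, so induces a self-equivalence `Ψ_U : C ⥲ C` over the
identity on base objects ("`p ∈ ℚ_p^×` is mapped to `p · u`, `u = 1 + p ∈ ℤ_p^×`"), and `Ψ_U` is not isomorphic
to `𝟭_C`: a natural isomorphism would force `(1 + p)^k = 1` in some `K_A`, `k ≠ 0`.
[cite: MochizukiFrdII2008, Rmk 1.2.2 p.10] -/
theorem rmk122_twist_holds : Rmk122_twist d := by
  intro hap hne
  obtain ⟨X, -⟩ := hne
  -- Step 1: the section
  obtain ⟨u, hu_div, hu_mem, hu_val, hu_nat⟩ := d.exists_unitSection_onePlusP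
  -- Step 2: the exponent function
  choose n hn using fun A b => d.exists_divZeroHom_resK_eq_zpow hap A b
  have hn_one : ∀ A, n A 1 = 0 := d.expFn_one n hn
  have hn_mul : ∀ A b c, n A (b * c) = n A b + n A c := d.expFn_mul n hn
  have hn_u : ∀ (A : D) (k : ℤ), n A ((u A ^ k : (d.B.obj (op A))ˣ) : d.B.obj (op A)) = 0 := fun A k => by
    apply d.expFn_eq n hn
    have h1 : divZeroHom (d.fld A) (d.resK A (u A : d.B.obj (op A))) = 1 := by
      have h0 := d.expFn_eq_zero_of_mem n hn (hu_mem A)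
      have h := hn A (u A : d.B.obj (op A))
      rwa [h0, zpow_zero] at h
    rw [map_units_zpow, map_zpow, h1, one_zpow, zpow_zero]
  have hu_map : ∀ {A A' : D} (f : A ⟶ A') (k : ℤ),
      (d.B.map f.op).hom ((u A' ^ k : (d.B.obj (op A'))ˣ) : d.B.obj (op A')) = (u A ^ k : (d.B.obj (op A))ˣ) :=
    fun {A A'} f k => by
    have h : Units.map (d.B.map f.op).hom (u A') = u A := Units.ext (hu_nat f)
    rw [← Units.coe_map, map_zpow, h]
  -- Step 3: the data automorphism `U = (id, β)`
  let βA : ∀ A : Dᵒᵖ, d.B.obj A →* d.B.obj A := fun A =>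
    { toFun := fun b => b * ((u A.unop ^ n A.unop b : (d.B.obj A)ˣ) : d.B.obj A)
      map_one' := by rw [hn_one, zpow_zero, Units.val_one, mul_one]
      map_mul' := fun b c => by rw [hn_mul, zpow_add, Units.val_mul, mul_mul_mul_comm] }
  have hβA : ∀ (A : Dᵒᵖ) (b : d.B.obj A),
      βA A b = b * ((u A.unop ^ n A.unop b : (d.B.obj A)ˣ) : d.B.obj A) := fun A b => rfl
  let β : d.B ⟶ d.B :=
    { app := fun A => CommMonCat.ofHom (βA A)
      naturality := fun A A' f => by
        obtain ⟨A⟩ := A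
        obtain ⟨A'⟩ := A'
        apply CommMonCat.hom_ext
        apply MonoidHom.ext
        intro b
        change βA (op A') ((d.B.map f).hom b) = (d.B.map f).hom (βA (op A) b)
        have e1 : n A' ((d.B.map f).hom b) = n A b := d.expFn_mapB n hn f.unop b
        have e2 : ∀ k : ℤ, (d.B.map f).hom ((u A ^ k : (d.B.obj (op A))ˣ) : d.B.obj (op A)) =
            (u A' ^ k : (d.B.obj (op A'))ˣ) := fun k => hu_map f.unop k
        rw [hβA, hβA, map_mul]
        dsimp only [Opposite.unop_op]
        rw [e2, e1] }
  let U : ModelFrobenioid.DataHom d.divB d.divB :=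
    { η := 𝟙 d.Φ
      β := β
      comm := fun A b => by
        obtain ⟨A⟩ := A
        change MonGp.map (MonoidHom.id _) (Frobenioids.divB d.Φ d.B d.divB (op A) b) =
          Frobenioids.divB d.Φ d.B d.divB (op A) (βA (op A) b)
        rw [MonGp.map_id, MonoidHom.id_apply, hβA, map_mul, map_units_zpow]
        change _ = _ * Frobenioids.divB d.Φ d.B d.divB (op A) (u A : d.B.obj (op A)) ^ n A b
        rw [hu_div A, one_zpow, mul_one] }
  have hbij : ∀ A : D, Bijective (βA (op A)) := fun A => by
    constructor
    · intro b c h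
      rw [hβA, hβA] at h
      change b * ((u A ^ n A b : (d.B.obj (op A))ˣ) : d.B.obj (op A)) =
        c * ((u A ^ n A c : (d.B.obj (op A))ˣ) : d.B.obj (op A)) at h
      have he : n A b = n A c := by
        have h' := congrArg (n A) h
        rwa [hn_mul, hn_mul, hn_u, hn_u, add_zero, add_zero] at h'
      rw [he] at h
      exact (Units.mul_left_inj _).mp h
    · intro c
      refine ⟨c * ((u A ^ (-(n A c)) : (d.B.obj (op A))ˣ) : d.B.obj (op A)), ?_⟩
      rw [hβA]
      change c * ((u A ^ (-(n A c)) : (d.B.obj (op A))ˣ) : d.B.obj (op A)) *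
          ((u A ^ n A (c * ((u A ^ (-(n A c)) : (d.B.obj (op A))ˣ) : d.B.obj (op A))) :
            (d.B.obj (op A))ˣ) : d.B.obj (op A)) = c
      rw [hn_mul, hn_u, add_zero, mul_assoc, ← Units.val_mul, ← zpow_add, neg_add_cancel, zpow_zero,
        Units.val_one, mul_one]
  have hU : d.IsDataAutomorphism U :=
    { η_eq := rfl
      bijective := fun A => by
        obtain ⟨A⟩ := A
        exact hbij A }
  haveI : U.functor.IsEquivalence := d.rmk122SelfEquivalence_holds U hU
  refine ⟨U.functor.asEquivalence, fun A => rfl, ⟨fun θ => ?_⟩⟩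
  -- Step 4: a natural isomorphism `θ : Ψ_U ≅ 𝟭` is absurd
  obtain ⟨⟨inst, hfin, hc⟩⟩ := d.isPadicLocal X.base
  letI := inst
  haveI := hfin
  haveI := isCancelMul_realification (OrdInt (d.fld X.base))
  -- a nonzero divisor `z ∈ Φ(A)`, its degree `k ≠ 0`, `u_e` over `(p^k, z)` and `e = (1, id, z, u_e)`
  obtain ⟨z, hz⟩ := d.exists_ne_one (op X.base)
  obtain ⟨ue₀, hue₀⟩ := d.divB_surjective_of_isAbsolutelyPrimitive hap X.base (Algebra.GrothendieckGroup.of z)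
  obtain ⟨k, hk⟩ : ∃ k : ℤ, divZeroHom (d.fld X.base) (d.resK X.base ue₀) =
      divZeroHom (d.fld X.base) (d.primeUnit X.base) ^ k := ⟨_, hn X.base ue₀⟩
  have hk0 : k ≠ 0 := by
    rintro rfl
    rw [zpow_zero, d.divZeroHom_resK, hue₀, MonGp.map_of] at hk
    have h1 : d.ιHom X.base z = 1 :=
      Algebra.GrothendieckGroup.of_injective (hk.trans (map_one _).symm)
    exact hz (d.ιHom_injective X.base (h1.trans (map_one (d.ιHom X.base)).symm))
  have hcompat : divZeroHom (d.fld (op X.base).unop) (d.primeUnit X.base ^ k) =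
      MonGp.map (d.ι.app (op X.base)).hom (Algebra.GrothendieckGroup.of z) := by
    rw [map_zpow, ← hk, ← hue₀]
    exact d.divZeroHom_resK X.base ue₀
  obtain ⟨ue, hue₁, hue₂⟩ := d.exists_B_of_compat (op X.base) (d.primeUnit X.base ^ k)
    (Algebra.GrothendieckGroup.of z) hcompat
  have hue₁' : d.resK X.base ue = d.primeUnit X.base ^ k := hue₁
  have hnue : n X.base ue = k := d.expFn_eq n hn (by rw [hue₁', map_zpow])
  let e : X ⟶ X := ModelFrobenioid.unitEnd X z ue hue₂.symm
  -- naturality of `θ` at `e`, rational-function components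
  have hnat := θ.hom.naturality e
  have hdeg : ModelFrobenioid.degFr (θ.hom.app X) = 1 := (ModelFrobenioid.degFr_hom_eq_one (θ.app X)).1
  obtain ⟨uθ, huθ⟩ : ∃ w : d.B.obj (op X.base), w = ModelFrobenioid.unit (θ.hom.app X) := ⟨_, rfl⟩
  obtain ⟨g, hg⟩ : ∃ g : X.base ⟶ X.base, g = ModelFrobenioid.baseMap (θ.hom.app X) := ⟨_, rfl⟩
  have key : (d.B.map (𝟙 X.base).op).hom uθ *
      (ue * ((u X.base ^ n X.base ue : (d.B.obj (op X.base))ˣ) : d.B.obj (op X.base))) ^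
        ((ModelFrobenioid.degFr (θ.hom.app X) : ℕ+) : ℕ) =
      (d.B.map g.op).hom ue * uθ ^ ((1 : ℕ+) : ℕ) := by
    subst huθ hg
    exact congrArg ModelFrobenioid.unit hnat
  rw [ModelFrobenioid.map_id_apply_B, hdeg, PNat.one_coe, pow_one, pow_one, hnue] at key
  -- the base component `g ∈ End_D(A)` of `θ_X` fixes `u_e` (it fixes `p` and acts trivially on `Φ(A)`)
  have hgue : (d.B.map g.op).hom ue = ue := by
    apply d.resK_ext X.base
    · rw [d.resK_mapB, hue₁', map_zpow, d.units_map_primeUnit]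
    · rw [← pullGp_divB]
      change MonGp.map (d.Φ.map g.op).hom _ = _
      rw [d.endTrivial g, CommMonCat.hom_id, MonGp.map_id, MonoidHom.id_apply]
  rw [hgue] at key
  -- hence `u_A^k = 1` in `B(A)`
  have hw : ((u X.base ^ k : (d.B.obj (op X.base))ˣ) : d.B.obj (op X.base)) = 1 := by
    have h1 : ue * ((u X.base ^ k : (d.B.obj (op X.base))ˣ) : d.B.obj (op X.base)) = ue * 1 :=
      (d.isUnit_B (op X.base) uθ).mul_left_cancel (by rw [mul_one, key, mul_comm])
    exact (d.isUnit_B (op X.base) ue).mul_left_cancel h1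
  -- restrict to `K^×`: `(1 + p)^k = 1`, absurd in characteristic zero
  have hK : (d.resK X.base (u X.base : d.B.obj (op X.base))) ^ k = 1 := by
    rw [← map_units_zpow, hw, map_one]
  have hfo : IsOfFinOrder (d.resK X.base (u X.base : d.B.obj (op X.base))) :=
    isOfFinOrder_iff_zpow_eq_one.mpr ⟨k, hk0, hK⟩
  obtain ⟨m, hm, hm1⟩ := isOfFinOrder_iff_pow_eq_one.mp hfo
  have hval := congrArg Units.val hm1
  rw [Units.val_pow_eq_pow_val, hu_val, Units.val_one] at hval
  -- pull back along the (injective) structure map `ℚ_p → K_A`: `(1 + p)^m = 1` in `ℚ_p`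
  have hQ : ((1 + (p : ℕ) : ℚ_[p])) ^ m = 1 := (algebraMap ℚ_[p] (d.fld X.base)).injective (by
    rw [map_pow, map_add, map_one, map_natCast]
    exact hval)
  have hnat' : ((1 + p) ^ m : ℕ) = 1 := by exact_mod_cast hQ
  have hp1 : 1 < 1 + p := by
    have := (Fact.out : p.Prime).one_lt
    omega
  exact absurd hnat' (Nat.one_lt_pow hm.ne' hp1).ne'

end Datum

end PadicFrd

end Literature.AlgebraicGeometry.Frobenioids
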